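import Summits.HodgeConjecture.HodgeConjecture.Cruxes.BlochSeedDiscOne.SeedChecker

/-!
# `Cruxes/BlochSeedDiscOne/SeedCheckerFrame.lean` — SEED CHECKER v7, satellite §10 of `SeedChecker.lean` (crux
# `EightfoldBlochSeeds.BlochSeedDiscOne`, item stmt-HodgeConjecture-18881): THE NORMALISED WEIL FRAME (obligation O-W♮) —
# the letters `e, ē` on `S = E₀ × E₀` from an `H¹`-eigenframe, `eeee = e⊠e⊠e⊠e`, `ēēēē`, and the Weil frame
# `r₁ = eeee + ēēēē`, `r₂ = i·(eeee − ēēēē)` CONSTRUCTED, with the dictionary `wOf μ = μ·eeee + μ̄·ēēēē` a THEOREM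

HONEST FRAMING. Typed by planner seat `hsemireg-c5c8-1` (g6; director-hodge g20 MINT block A5 «C5–C8 as predicates on (design
json, presentation); flag the vacuous ∕ implied ones; state nothing proved») for the computation cell `pub-hsemireg`. Line of
record: `Cruxes/BlochSeedDiscOne/Lines/birth.lean` 814a6a70c14e831a, stub `stub_rung_pad4_seedAt`. This satellite imports
`SeedChecker.lean` v4 (13437bb9848c3c36) UNCHANGED and sits BESIDE `SeedCheckerPorteous.lean` v5 (0e6fc41a4915935f) and
`SeedCheckerKit.lean` v6.2 (91dde06873600691) in the same namespace: no name of v4 ∕ v5 ∕ v6 is restated or shadowed, and neither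
v5 nor v6 is imported (their farm snapshot is not yet rebuilt), so the three satellites can be read in any order. NOTHING here is
proved toward HC ∕ HC_CM ∕ HC_AV ∕ №4 ∕ 26512 ∕ 18881 ∕ H2: no design is realised, no bundle ∕ section ∕ subscheme is exhibited, the
stub stays open. What IS proved is anchor-level, design-independent linear algebra in `H^*(E₀⁸(ℂ); ℂ)`.

WHY THIS FILE (the flag v6 left open, «O-W♮»). v4 §3 typed the Weil frame as an INTERFACE `WeilFrame E₀ ψ₀` (two rational,
independent classes `r₁, r₂` of the Weil plane of `(S⁴, ψ)`) and defined the class a design names as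
`wOf μ := Re μ · r₁ + Im μ · r₂`, ANNOUNCING the dictionary `r₁ = eeee + ēēēē`, `r₂ = i(eeee − ēēēē)` — so that `wOf μ = μ·eeee + μ̄·ēēēē`
is the `W`-component the cell's json records as the `eeee`-coefficient `μ` (C0). v6 discharged O-W only as EXISTENCE of SOME rational
frame (`weilFrame_nonempty`, opaque, by choice), for which `wOf μ` is NOT the json's class. Here the normalised frame is BUILT:

§10.1 `IsGaussRat c` («`c = a + i·b`, `a, b` rational classes») and its closure under `+ − i· f^* ∪` and conjugation
(`conj c = a − i·b`, so `c + conj c` and `i(c − conj c)` are RATIONAL) — the only number theory the frame needs (`ℚ(i) = K` at `d = 1`).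
§10.2 THE `H¹`-EIGENFRAME of `(E₀, ψ₀)`, `ψ₀² = −1`: from ANY rational `v ≠ 0` in `H¹(E₀(ℂ); ℂ)` (exists: `exists_isRationalClass_ne_zero_one`),
`x⁺ = v − i·ψ₀^*v` (`ψ₀^*x⁺ = i·x⁺`), `x⁻ = v + i·ψ₀^*v` (`ψ₀^*x⁻ = −i·x⁻`), both `≠ 0` (`linearIndependent_pair_map_one`), `conj x⁺ = x⁻`,
Gauss-rational.
§10.3 THE LETTERS on the Weil surface `(S, φ_S) = (E₀ × E₀, ψ₀ × (−ψ₀))`: `e := pr₁^*x⁺ ∪ pr₂^*x⁻ ∈ E₊(S) = weilClassesPlus S φ_S 1 1`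
(the `+i`-eigenline `V₊(S) = ⟨(x⁺, 0), (0, x⁻)⟩`, so `⋀²V₊ = e`), `ē := pr₁^*x⁻ ∪ pr₂^*x⁺ ∈ E₋(S)`, `conj e = ē`, `e, ē ≠ 0`
(`cupProduct_map_fst_map_snd_ne_zero_of_add_eq`, Künneth injectivity), Gauss-rational.
§10.4 THE TOWER `cross b c := pr₁^*b ∪ pr₂^*c` on `B × S`, nested EXACTLY as `pad4Anchor E₀ = ((S × S) × S) × S` and
`pad4Action = prodLift (fst ≫ ·) (snd ≫ φ_S)`: `eeee := cross (cross (cross e e) e) e ∈ E₊(S⁴) = weilClassesPlus (pad4Anchor E₀)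
(pad4Action E₀ ψ₀) 4 1` (`cupProduct_map_fst_map_snd_mem_weilClassesPlus` ×3), `ēēēē ∈ E₋(S⁴)`, `conj eeee = ēēēē`
(`conjClass_cupProduct`, `conjClass_map`), both `≠ 0`, Gauss-rational.
§10.5 **`normalisedFrame hE hψ hv hv0 : WeilFrame E₀ ψ₀`** with `rOne = eeee + ēēēē`, `rTwo = i·(eeee − ēēēē)` — rational by §10.1,
in the Weil plane, `ℂ`-independent because `E₊ ∩ E₋ = 0` (`disjoint_weilClassesPlus_weilClassesMinus`) and `eeee, ēēēē ≠ 0`;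
**THE DICTIONARY THEOREM `normalisedFrame_wOf : wOf μ = μ·eeee + μ̄·ēēēē`** (`μ̄ = star μ`, `ℤ[i] → ℂ` = `GaussianInt.toComplex`);
`WeilFrame.wOf_sub`, `WeilFrame.wOf_injective` (for ANY v4 frame: the `eeee`-coefficient is DETERMINED by the Weil class) and
`eq_of_eeee_combination_eq` (`μ·eeee + μ̄·ēēēē = ν·eeee + ν̄·ēēēē ⟹ μ = ν`: the json's `μ` is read off the class unambiguously).
§10.6 CONSUMERS RE-READ through the normalised frame: `AnchorKit.ofNormalisedFrame` (a kit whose frame IS the json dictionary, from a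
polarisation datum and O-hyp — both theorems of v6 once its snapshot builds: `exists_polarisation` ∕ `polarisation_nonempty`,
`hStd_hyperbolic`); `cleanAtSeed_normalisedFrame_iff` — (A1@Z) AT THE SEED now literally reads `ch₄(𝓔) = q·h⁴ + μ·eeee + μ̄·ēēēē`;
`classCheck_ofNormalisedFrame_iff` — (σ) reads `q·h_K⁴ + μ·eeee + μ̄·ēēēē` supported on `Z`, `μ ≠ 0`; `WordFrame.linksTo_normalisedFrame`
— law (F2) of the word frame is DEFINITIONAL for the normalised frame (what remains of O-WF is (F1) alone: the e-free words and
`Σ_{e-free, deg p} w = hᵖ∕p!`, i.e. the letters `u_f, v_f, p_f` and `u_f² = v_f² = 0` — NOT constructed here).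
§10.7 DEPENDENCE ON `v` (the old pencil flag, now TYPED): `V₊(ψ₀)` is a LINE (`exists_eq_smul_xPlus`, from `b₁ = 2` and
`dim V₊ = dim V₋`), so for two rational generators `v, v' ≠ 0`: `x'⁺ = t·x⁺`, `x'⁻ = t̄·x⁻`, `e' = |t|²·e`, `ē' = |t|²·ē`,
`eeee' = |t|⁸·eeee`, `ēēēē' = |t|⁸·ēēēē` with ONE real `r = |t|² > 0` (`exists_letters_eq_smul`); the two normalised frames differ by
the positive real scale `r⁴` on EVERY `wOf μ` (`exists_normalisedFrame_wOf_eq_smul`); `eeee, ēēēē` are independent (`eeee_eeeeBar_indep`);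
a class named `μ'` in one frame and `μ` in the other forces `μ = r⁴·μ'` in `ℂ` (`toComplex_eq_real_mul_of_wOf_eq`), and a real ratio of
Gaussian integers is RATIONAL (`toComplex_eq_real_mul`): the json's `μ` is anchor-intrinsic UP TO `ℚ_{>0}` — harmless for (σ) (`μ ≠ 0`)
and for the `ℚ(i)`-line a design names.

FLAGS (honest). (1) The frame depends on the choice of the rational `v` exactly up to the positive real (indeed rational) scale of
§10.7 — an ABSOLUTE normalisation (`μ` on the nose) would need the divisor letters: (2) `e` is normalised by `x⁺ ∪ x⁻`, not by an
identity `e + ē ∈ ℚ[u, v, p]` — such identities with the divisor letters are (F1)-side and untouched; `ℚ[h]₄ ∩ W = 0` (so `μ` is read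
off `ch₄` itself, not only off its `W`-component) is likewise NOT typed here. (3) As v4–v6: every door stays hypothesis-carrying;
(d=1) vacuous per design; (σ) design half = C0 `μ ≠ 0`; nothing is a rung.

Sources: van Geemen, *An introduction to the Hodge conjecture for abelian varieties* (1994) 4.9–4.11, Lemma 5.2 (6), proof of
Thm. 6.12 [vanGeemen1994HodgeAV]; Schoen, *Addendum* (1998) §10 [Schoen1998HodgeWeilAddendum]; Voisin, *Hodge Theory I* Cor. 6.12
(conjugation) [VoisinHodgeI2002]; Hatcher, *Algebraic Topology* Thm. 3.16, Prop. 3.10 (cross product, naturality) [HatcherAT2002];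
Birkenhake–Lange §1.1 (`(−f)^* = −f^*` on `H¹`) [LangeBirkenhake1992].
-/

noncomputable section

set_option linter.dupNamespace false

open CategoryTheory AlgebraicGeometry
open Literature.AlgebraicGeometry Literature.AlgebraicGeometry.Motives Literature.AlgebraicGeometry.HodgeTheory
open Literature.AlgebraicTopology.SingularHomology

namespace Summit.HodgeConjecture.HodgeConjecture.Cruxes.BlochSeedDiscOne.SeedChecker

open Summit.HodgeConjecture.HodgeConjecture.Cruxes.BlochSeedDiscOne.Anchor
open Summit.Ventures.HSemireg Summit.Ventures.HSemireg.Pad4Tower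

/-! ## §10.1 Gauss-rational classes `c = a + i·b` -/

section GaussRat

variable {Y : Type} [TopologicalSpace Y] {k : ℕ}

/-- **`c ∈ Hᵏ(Y; ℂ)` is GAUSS-RATIONAL**: `c = a + i·b` with `a, b` rational classes (`c ∈ Hᵏ(Y; ℚ) ⊗ ℚ(i)`).
[cite: vanGeemen1994HodgeAV, 4.9] -/
def IsGaussRat (c : singularCohomology ℂ ℂ Y k) : Prop :=
  ∃ a b : singularCohomology ℂ ℂ Y k, IsRationalClass a ∧ IsRationalClass b ∧ c = a + Complex.I • b

theorem isGaussRat_of_isRationalClass {c : singularCohomology ℂ ℂ Y k} (hc : IsRationalClass c) : IsGaussRat c :=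
  ⟨c, 0, hc, IsRationalClass.zero, by rw [smul_zero, add_zero]⟩

namespace IsGaussRat

theorem add {c c' : singularCohomology ℂ ℂ Y k} (hc : IsGaussRat c) (hc' : IsGaussRat c') : IsGaussRat (c + c') := by
  obtain ⟨a, b, ha, hb, rfl⟩ := hc
  obtain ⟨a', b', ha', hb', rfl⟩ := hc'
  exact ⟨a + a', b + b', ha.add ha', hb.add hb', by rw [smul_add]; abel⟩

theorem sub {c c' : singularCohomology ℂ ℂ Y k} (hc : IsGaussRat c) (hc' : IsGaussRat c') : IsGaussRat (c - c') := by
  obtain ⟨a, b, ha, hb, rfl⟩ := hc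
  obtain ⟨a', b', ha', hb', rfl⟩ := hc'
  exact ⟨a - a', b - b', ha.sub ha', hb.sub hb', by rw [smul_sub]; abel⟩

/-- `i·(a + i b) = −b + i a`. -/
theorem smul_I {c : singularCohomology ℂ ℂ Y k} (hc : IsGaussRat c) : IsGaussRat (Complex.I • c) := by
  obtain ⟨a, b, ha, hb, rfl⟩ := hc
  refine ⟨0 - b, a, IsRationalClass.zero.sub hb, ha, ?_⟩
  rw [smul_add, smul_smul, Complex.I_mul_I, zero_sub, neg_one_smul, add_comm]

theorem ratSmul {c : singularCohomology ℂ ℂ Y k} (hc : IsGaussRat c) (q : ℚ) : IsGaussRat (((q : ℚ) : ℂ) • c) := by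
  obtain ⟨a, b, ha, hb, rfl⟩ := hc
  exact ⟨_, _, ha.smul q, hb.smul q, by rw [smul_add, smul_comm]⟩

/-- pull-backs of Gauss-rational classes are Gauss-rational. -/
theorem map {Y' : Type} [TopologicalSpace Y'] (f : C(Y', Y)) {c : singularCohomology ℂ ℂ Y k} (hc : IsGaussRat c) :
    IsGaussRat (singularCohomology.map ℂ ℂ f k c) := by
  obtain ⟨a, b, ha, hb, rfl⟩ := hc
  exact ⟨_, _, ha.map f, hb.map f, by rw [map_add, map_smul]⟩

/-- cup products of Gauss-rational classes are Gauss-rational: `(a + ib)(a' + ib') = (aa' − bb') + i(ab' + ba')`. -/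
theorem cup {p q m : ℕ} (h : p + q = m) {a : singularCohomology ℂ ℂ Y p} {b : singularCohomology ℂ ℂ Y q}
    (ha : IsGaussRat a) (hb : IsGaussRat b) : IsGaussRat (cupProduct h a b) := by
  obtain ⟨a₁, a₂, ha₁, ha₂, rfl⟩ := ha
  obtain ⟨b₁, b₂, hb₁, hb₂, rfl⟩ := hb
  refine ⟨cupProduct h a₁ b₁ - cupProduct h a₂ b₂, cupProduct h a₁ b₂ + cupProduct h a₂ b₁,
    (ha₁.cup h hb₁).sub (ha₂.cup h hb₂), (ha₁.cup h hb₂).add (ha₂.cup h hb₁), ?_⟩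
  simp only [map_add, map_smul, LinearMap.add_apply, LinearMap.smul_apply, smul_add, smul_smul, Complex.I_mul_I]
  module

/-- **`conj (a + i b) = a − i b`** (rational classes are real: `IsRationalClass.conjClass_eq`). [cite: VoisinHodgeI2002, Cor. 6.12] -/
theorem conjClass_eq_of_eq {c a b : singularCohomology ℂ ℂ Y k} (ha : IsRationalClass a) (hb : IsRationalClass b)
    (h : c = a + Complex.I • b) : conjClass Y k c = a - Complex.I • b := by
  rw [h, conjClass_add, conjClass_smul, ha.conjClass_eq, hb.conjClass_eq, Complex.conj_I, neg_smul, sub_eq_add_neg]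

/-- the conjugate of a Gauss-rational class is Gauss-rational. -/
theorem conjClass {c : singularCohomology ℂ ℂ Y k} (hc : IsGaussRat c) : IsGaussRat (conjClass Y k c) := by
  obtain ⟨a, b, ha, hb, rfl⟩ := hc
  refine ⟨a, 0 - b, ha, IsRationalClass.zero.sub hb, ?_⟩
  rw [conjClass_eq_of_eq ha hb rfl, zero_sub, smul_neg, sub_eq_add_neg]

/-- **`c + conj c` is RATIONAL** (`= 2a`). -/
theorem add_conjClass_rational {c : singularCohomology ℂ ℂ Y k} (hc : IsGaussRat c) :
    IsRationalClass (c + _root_.Literature.AlgebraicGeometry.HodgeTheory.conjClass Y k c) := by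
  obtain ⟨a, b, ha, hb, rfl⟩ := hc
  rw [conjClass_eq_of_eq ha hb rfl, show a + Complex.I • b + (a - Complex.I • b) = a + a by abel]
  exact ha.add ha

/-- **`i·(c − conj c)` is RATIONAL** (`= −2b`). -/
theorem I_smul_sub_conjClass_rational {c : singularCohomology ℂ ℂ Y k} (hc : IsGaussRat c) :
    IsRationalClass (Complex.I • (c - _root_.Literature.AlgebraicGeometry.HodgeTheory.conjClass Y k c)) := by
  obtain ⟨a, b, ha, hb, rfl⟩ := hc
  rw [conjClass_eq_of_eq ha hb rfl]
  have e : Complex.I • (a + Complex.I • b - (a - Complex.I • b)) = 0 - (b + b) := by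
    simp only [smul_sub, smul_add, smul_smul, Complex.I_mul_I]
    module
  rw [e]
  exact IsRationalClass.zero.sub (hb.add hb)

end IsGaussRat

end GaussRat

/-- `conj (f^* c) = f^* (conj c)` in the tree's `complexBetti.map` form (`conjClass_map` through the `abbrev`). -/
private theorem conjClass_complexBetti_map' {X Y : SchemeOver ℂ} (f : X ⟶ Y) {k : ℕ} (c : complexBetti Y k) :
    conjClass (ComplexPoints X) k (complexBetti.map f k c) = complexBetti.map f k (conjClass (ComplexPoints Y) k c) :=
  conjClass_map _ c

/-! ## §10.2 The `H¹`-eigenframe `x⁺ = v − i·ψ₀^*v`, `x⁻ = v + i·ψ₀^*v` of `(E₀, ψ₀)`, `ψ₀² = −1` -/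

section EigenFrame

variable {E₀ : AbelianVariety ℂ} (ψ₀ : E₀ ⟶ E₀)

/-- `x⁺_v = v − i·ψ₀^*v`, the `+i`-eigenclass of `ψ₀^*` on `H¹(E₀(ℂ); ℂ)` through the rational class `v`. -/
def xPlus (v : complexBetti E₀.X 1) : complexBetti E₀.X 1 := v - Complex.I • complexBetti.map ψ₀.hom.hom.hom 1 v

/-- `x⁻_v = v + i·ψ₀^*v = conj x⁺_v`, the `−i`-eigenclass. -/
def xMinus (v : complexBetti E₀.X 1) : complexBetti E₀.X 1 := v + Complex.I • complexBetti.map ψ₀.hom.hom.hom 1 v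

variable {ψ₀}

/-- `ψ₀^* x⁺ = i·x⁺` (`ψ₀^*ψ₀^* = −1` on `H¹`, `complexBetti_map_map_one_of_comp_self`). [cite: vanGeemen1994HodgeAV, 4.9] -/
theorem map_xPlus (hψ : ψ₀ ≫ ψ₀ = -(1 • 𝟙 E₀)) (v : complexBetti E₀.X 1) :
    complexBetti.map ψ₀.hom.hom.hom 1 (xPlus ψ₀ v) = Complex.I • xPlus ψ₀ v := by
  simp only [xPlus, map_sub, map_smul, complexBetti_map_map_one_of_comp_self hψ, Nat.cast_one, one_smul, smul_sub,
    smul_neg, smul_smul, Complex.I_mul_I]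
  module

/-- `ψ₀^* x⁻ = −i·x⁻`. -/
theorem map_xMinus (hψ : ψ₀ ≫ ψ₀ = -(1 • 𝟙 E₀)) (v : complexBetti E₀.X 1) :
    complexBetti.map ψ₀.hom.hom.hom 1 (xMinus ψ₀ v) = -(Complex.I • xMinus ψ₀ v) := by
  simp only [xMinus, map_add, map_smul, complexBetti_map_map_one_of_comp_self hψ, Nat.cast_one, one_smul, smul_add,
    smul_neg, smul_smul, Complex.I_mul_I]
  module

/-- `(−ψ₀)^* c = −ψ₀^* c` on `H¹`. [cite: LangeBirkenhake1992, §1.1 (p. 19)] -/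
theorem map_neg_one_apply (c : complexBetti E₀.X 1) :
    complexBetti.map (-ψ₀).hom.hom.hom 1 c = -complexBetti.map ψ₀.hom.hom.hom 1 c := by
  change (complexBetti.map (-ψ₀).hom.hom.hom 1).hom c = _
  rw [complexBetti_map_neg_one, ModuleCat.hom_neg, LinearMap.neg_apply]

/-- `(−ψ₀)^* x⁻ = i·x⁻`. -/
theorem map_neg_xMinus (hψ : ψ₀ ≫ ψ₀ = -(1 • 𝟙 E₀)) (v : complexBetti E₀.X 1) :
    complexBetti.map (-ψ₀).hom.hom.hom 1 (xMinus ψ₀ v) = Complex.I • xMinus ψ₀ v := by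
  rw [map_neg_one_apply, map_xMinus hψ, neg_neg]

/-- `(−ψ₀)^* x⁺ = −i·x⁺`. -/
theorem map_neg_xPlus (hψ : ψ₀ ≫ ψ₀ = -(1 • 𝟙 E₀)) (v : complexBetti E₀.X 1) :
    complexBetti.map (-ψ₀).hom.hom.hom 1 (xPlus ψ₀ v) = -(Complex.I • xPlus ψ₀ v) := by
  rw [map_neg_one_apply, map_xPlus hψ]

/-- `x⁺ ∈ V₊(ψ₀)`, the `+i√1`-character eigenclasses in degree `1`. -/
theorem xPlus_mem (hψ : ψ₀ ≫ ψ₀ = -(1 • 𝟙 E₀)) (v : complexBetti E₀.X 1) :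
    xPlus ψ₀ v ∈ pullbackEigenclasses E₀ ψ₀ 1 (fun x y => (x : ℂ) + (y : ℂ) * Complex.I * (Real.sqrt (1 : ℕ) : ℂ)) := by
  rw [pullbackEigenclasses_one_eq_eigenspace, Module.End.mem_eigenspace_iff]
  change complexBetti.map ψ₀.hom.hom.hom 1 (xPlus ψ₀ v) = _
  rw [map_xPlus hψ, Nat.cast_one, Real.sqrt_one, Complex.ofReal_one, mul_one]

/-- `x⁻ ∈ V₋(ψ₀)`. -/
theorem xMinus_mem (hψ : ψ₀ ≫ ψ₀ = -(1 • 𝟙 E₀)) (v : complexBetti E₀.X 1) :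
    xMinus ψ₀ v ∈ pullbackEigenclasses E₀ ψ₀ 1 (fun x y => (x : ℂ) - (y : ℂ) * Complex.I * (Real.sqrt (1 : ℕ) : ℂ)) := by
  rw [pullbackEigenclasses_one_eq_eigenspace_neg, Module.End.mem_eigenspace_iff]
  change complexBetti.map ψ₀.hom.hom.hom 1 (xMinus ψ₀ v) = _
  rw [map_xMinus hψ, Nat.cast_one, Real.sqrt_one, Complex.ofReal_one, mul_one, neg_smul]

/-- `x⁻ ∈ V₊(−ψ₀)` (the second factor of the Weil surface carries `−ψ₀`). -/
theorem xMinus_mem_neg (hψ : ψ₀ ≫ ψ₀ = -(1 • 𝟙 E₀)) (v : complexBetti E₀.X 1) :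
    xMinus ψ₀ v ∈ pullbackEigenclasses E₀ (-ψ₀) 1 (fun x y => (x : ℂ) + (y : ℂ) * Complex.I * (Real.sqrt (1 : ℕ) : ℂ)) := by
  rw [pullbackEigenclasses_one_eq_eigenspace, Module.End.mem_eigenspace_iff]
  change complexBetti.map (-ψ₀).hom.hom.hom 1 (xMinus ψ₀ v) = _
  rw [map_neg_xMinus hψ, Nat.cast_one, Real.sqrt_one, Complex.ofReal_one, mul_one]

/-- `x⁺ ∈ V₋(−ψ₀)`. -/
theorem xPlus_mem_neg (hψ : ψ₀ ≫ ψ₀ = -(1 • 𝟙 E₀)) (v : complexBetti E₀.X 1) :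
    xPlus ψ₀ v ∈ pullbackEigenclasses E₀ (-ψ₀) 1 (fun x y => (x : ℂ) - (y : ℂ) * Complex.I * (Real.sqrt (1 : ℕ) : ℂ)) := by
  rw [pullbackEigenclasses_one_eq_eigenspace_neg, Module.End.mem_eigenspace_iff]
  change complexBetti.map (-ψ₀).hom.hom.hom 1 (xPlus ψ₀ v) = _
  rw [map_neg_xPlus hψ, Nat.cast_one, Real.sqrt_one, Complex.ofReal_one, mul_one, neg_smul]

/-- `x⁺ ≠ 0` for a rational `v ≠ 0` (`v, ψ₀^*v` are `ℂ`-independent, `linearIndependent_pair_map_one`). -/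
theorem xPlus_ne_zero (hψ : ψ₀ ≫ ψ₀ = -(1 • 𝟙 E₀)) {v : complexBetti E₀.X 1} (hv : IsRationalClass v)
    (hv0 : v ≠ 0) : xPlus ψ₀ v ≠ 0 := by
  intro h
  have h' : (1 : ℂ) • v + (-Complex.I) • complexBetti.map ψ₀.hom.hom.hom 1 v = 0 := by
    rw [one_smul, neg_smul, ← sub_eq_add_neg]; exact h
  exact one_ne_zero (LinearIndependent.pair_iff.1 (linearIndependent_pair_map_one one_pos hψ hv hv0) _ _ h').1

/-- `x⁻ ≠ 0`. -/
theorem xMinus_ne_zero (hψ : ψ₀ ≫ ψ₀ = -(1 • 𝟙 E₀)) {v : complexBetti E₀.X 1} (hv : IsRationalClass v)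
    (hv0 : v ≠ 0) : xMinus ψ₀ v ≠ 0 := by
  intro h
  have h' : (1 : ℂ) • v + Complex.I • complexBetti.map ψ₀.hom.hom.hom 1 v = 0 := by
    rw [one_smul]; exact h
  exact one_ne_zero (LinearIndependent.pair_iff.1 (linearIndependent_pair_map_one one_pos hψ hv hv0) _ _ h').1

/-- `x⁺` is Gauss-rational (`a = v`, `b = −ψ₀^*v`). -/
theorem xPlus_gaussRat {v : complexBetti E₀.X 1} (hv : IsRationalClass v) : IsGaussRat (xPlus ψ₀ v) :=
  ⟨v, 0 - complexBetti.map ψ₀.hom.hom.hom 1 v, hv, IsRationalClass.zero.sub (hv.map _),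
    by rw [xPlus, zero_sub, smul_neg, sub_eq_add_neg]⟩

/-- `x⁻` is Gauss-rational. -/
theorem xMinus_gaussRat {v : complexBetti E₀.X 1} (hv : IsRationalClass v) : IsGaussRat (xMinus ψ₀ v) :=
  ⟨v, complexBetti.map ψ₀.hom.hom.hom 1 v, hv, hv.map _, rfl⟩

/-- **`conj x⁺ = x⁻`.** [cite: VoisinHodgeI2002, Cor. 6.12] -/
theorem conjClass_xPlus {v : complexBetti E₀.X 1} (hv : IsRationalClass v) :
    conjClass (ComplexPoints E₀.X) 1 (xPlus ψ₀ v) = xMinus ψ₀ v := by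
  rw [xPlus, conjClass_sub, conjClass_smul, hv.conjClass_eq, (hv.map _).conjClass_eq, Complex.conj_I, neg_smul,
    sub_neg_eq_add]
  rfl

/-- **`conj x⁻ = x⁺`.** -/
theorem conjClass_xMinus {v : complexBetti E₀.X 1} (hv : IsRationalClass v) :
    conjClass (ComplexPoints E₀.X) 1 (xMinus ψ₀ v) = xPlus ψ₀ v := by
  rw [← conjClass_xPlus hv, conjClass_conjClass]

end EigenFrame

/-! ## §10.3 The letters `e, ē` on the Weil surface `(S, φ_S) = (E₀ × E₀, ψ₀ × (−ψ₀))` -/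

section LettersOnS

variable {E₀ : AbelianVariety ℂ} (ψ₀ : E₀ ⟶ E₀)

theorem one_add_one_eq_two_mul_one : 1 + 1 = 2 * 1 := rfl

/-- **the letter `e = pr₁^*x⁺ ∪ pr₂^*x⁻ ∈ H²(S(ℂ); ℂ)`** (`= ⋀² V₊(S)`, `V₊(S) = ⟨(x⁺, 0), (0, x⁻)⟩` the `+i`-eigenplane
of `φ_S^* = (ψ₀ × (−ψ₀))^*` on `H¹(S)`). [cite: vanGeemen1994HodgeAV, proof of Thm. 6.12] -/
def eLetter (v : complexBetti E₀.X 1) : complexBetti (weilSurf E₀).X (2 * 1) :=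
  cupProduct one_add_one_eq_two_mul_one
    (complexBetti.map (AbelianVariety.fst E₀ E₀).hom.hom.hom 1 (xPlus ψ₀ v))
    (complexBetti.map (AbelianVariety.snd E₀ E₀).hom.hom.hom 1 (xMinus ψ₀ v))

/-- **the letter `ē = pr₁^*x⁻ ∪ pr₂^*x⁺ ∈ H²(S(ℂ); ℂ)`** (`= ⋀² V₋(S)`). -/
def ebarLetter (v : complexBetti E₀.X 1) : complexBetti (weilSurf E₀).X (2 * 1) :=
  cupProduct one_add_one_eq_two_mul_one
    (complexBetti.map (AbelianVariety.fst E₀ E₀).hom.hom.hom 1 (xMinus ψ₀ v))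
    (complexBetti.map (AbelianVariety.snd E₀ E₀).hom.hom.hom 1 (xPlus ψ₀ v))

variable {ψ₀}

private theorem chiPlus_sq :
    (fun x y : ℕ => ((x : ℂ) + (y : ℂ) * Complex.I * (Real.sqrt (1 : ℕ) : ℂ)) *
        ((x : ℂ) + (y : ℂ) * Complex.I * (Real.sqrt (1 : ℕ) : ℂ))) =
      fun x y : ℕ => ((x : ℂ) + (y : ℂ) * Complex.I * (Real.sqrt (1 : ℕ) : ℂ)) ^ (2 * 1) := by
  funext x y; ring

private theorem chiMinus_sq :
    (fun x y : ℕ => ((x : ℂ) - (y : ℂ) * Complex.I * (Real.sqrt (1 : ℕ) : ℂ)) *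
        ((x : ℂ) - (y : ℂ) * Complex.I * (Real.sqrt (1 : ℕ) : ℂ))) =
      fun x y : ℕ => ((x : ℂ) - (y : ℂ) * Complex.I * (Real.sqrt (1 : ℕ) : ℂ)) ^ (2 * 1) := by
  funext x y; ring

/-- **`e ∈ E₊(S) = weilClassesPlus (weilSurf E₀) (weilSurfAct E₀ ψ₀) 1 1`** (characters multiply:
`cupProduct_map_fst_map_snd_mem_pullbackEigenclasses`). [cite: Schoen1998HodgeWeilAddendum, §10] -/
theorem eLetter_mem (hψ : ψ₀ ≫ ψ₀ = -(1 • 𝟙 E₀)) (v : complexBetti E₀.X 1) :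
    eLetter ψ₀ v ∈ weilClassesPlus (weilSurf E₀) (weilSurfAct E₀ ψ₀) 1 1 := by
  have h := cupProduct_map_fst_map_snd_mem_pullbackEigenclasses one_add_one_eq_two_mul_one
    (AbelianVariety.prodLift_fst _ _) (AbelianVariety.prodLift_snd _ _) (xPlus_mem hψ v) (xMinus_mem_neg hψ v)
  rw [chiPlus_sq] at h
  exact h

/-- **`ē ∈ E₋(S)`.** -/
theorem ebarLetter_mem (hψ : ψ₀ ≫ ψ₀ = -(1 • 𝟙 E₀)) (v : complexBetti E₀.X 1) :
    ebarLetter ψ₀ v ∈ weilClassesMinus (weilSurf E₀) (weilSurfAct E₀ ψ₀) 1 1 := by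
  have h := cupProduct_map_fst_map_snd_mem_pullbackEigenclasses one_add_one_eq_two_mul_one
    (AbelianVariety.prodLift_fst _ _) (AbelianVariety.prodLift_snd _ _) (xMinus_mem hψ v) (xPlus_mem_neg hψ v)
  rw [chiMinus_sq] at h
  exact h

/-- **`e ≠ 0`** (Künneth: `pr₁^*x ∪ pr₂^*y ≠ 0` for `x, y ≠ 0`). [cite: HatcherAT2002, Thm. 3.16] -/
theorem eLetter_ne_zero (hE : E₀.dim = 1) (hψ : ψ₀ ≫ ψ₀ = -(1 • 𝟙 E₀)) {v : complexBetti E₀.X 1}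
    (hv : IsRationalClass v) (hv0 : v ≠ 0) : eLetter ψ₀ v ≠ 0 :=
  cupProduct_map_fst_map_snd_ne_zero_of_add_eq (isSmoothProjective_of_dim_eq' hE) (isSmoothProjective_of_dim_eq' hE)
    one_add_one_eq_two_mul_one (by omega) (xPlus_ne_zero hψ hv hv0) (xMinus_ne_zero hψ hv hv0)

/-- **`ē ≠ 0`.** -/
theorem ebarLetter_ne_zero (hE : E₀.dim = 1) (hψ : ψ₀ ≫ ψ₀ = -(1 • 𝟙 E₀)) {v : complexBetti E₀.X 1}
    (hv : IsRationalClass v) (hv0 : v ≠ 0) : ebarLetter ψ₀ v ≠ 0 :=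
  cupProduct_map_fst_map_snd_ne_zero_of_add_eq (isSmoothProjective_of_dim_eq' hE) (isSmoothProjective_of_dim_eq' hE)
    one_add_one_eq_two_mul_one (by omega) (xMinus_ne_zero hψ hv hv0) (xPlus_ne_zero hψ hv hv0)

/-- `e` is Gauss-rational. -/
theorem eLetter_gaussRat {v : complexBetti E₀.X 1} (hv : IsRationalClass v) : IsGaussRat (eLetter ψ₀ v) :=
  ((xPlus_gaussRat hv).map _).cup _ ((xMinus_gaussRat hv).map _)

/-- `ē` is Gauss-rational. -/
theorem ebarLetter_gaussRat {v : complexBetti E₀.X 1} (hv : IsRationalClass v) : IsGaussRat (ebarLetter ψ₀ v) :=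
  ((xMinus_gaussRat hv).map _).cup _ ((xPlus_gaussRat hv).map _)

/-- **`conj e = ē`** (`conj` is multiplicative and natural: `conjClass_cupProduct`, `conjClass_map`).
[cite: VoisinHodgeI2002, Cor. 6.12] [cite: vanGeemen1994HodgeAV, proof of Lemma 5.2 (6)] -/
theorem conjClass_eLetter {v : complexBetti E₀.X 1} (hv : IsRationalClass v) :
    conjClass (ComplexPoints (weilSurf E₀).X) (2 * 1) (eLetter ψ₀ v) = ebarLetter ψ₀ v := by
  rw [eLetter, conjClass_cupProduct, conjClass_complexBetti_map', conjClass_complexBetti_map', conjClass_xPlus hv,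
    conjClass_xMinus hv]
  rfl

end LettersOnS

/-! ## §10.4 The tower `cross b c = pr₁^*b ∪ pr₂^*c` on `B × S`, nested as `pad4Anchor ∕ pad4Action` -/

section Tower

variable {E₀ : AbelianVariety ℂ} {B : AbelianVariety ℂ}

/-- **the exterior product `pr₁^*b ∪ pr₂^*c ∈ H^{2(n+1)}((B × S)(ℂ); ℂ)`** of `b ∈ H^{2n}(B)` and a surface class
`c ∈ H²(S)` — ONE STEP of the nested tower `S⁴ = ((S × S) × S) × S`. [cite: HatcherAT2002, Thm. 3.16] -/
def cross {n : ℕ} (b : complexBetti B.X (2 * n)) (c : complexBetti (weilSurf E₀).X (2 * 1)) :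
    complexBetti (B.prod (weilSurf E₀)).X (2 * (n + 1)) :=
  cupProduct (two_mul_add_two_mul n 1)
    (complexBetti.map (AbelianVariety.fst B (weilSurf E₀)).hom.hom.hom (2 * n) b)
    (complexBetti.map (AbelianVariety.snd B (weilSurf E₀)).hom.hom.hom (2 * 1) c)

variable {ψ₀ : E₀ ⟶ E₀} {β : B ⟶ B} {n : ℕ}

/-- `E₊(B) ⊠ E₊(S) ⊆ E₊(B × S)` for the product action `prodLift (fst ≫ β) (snd ≫ φ_S)` — LITERALLY the shape of
`pad{k+1}Action`. [cite: Schoen1998HodgeWeilAddendum, §10] -/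
theorem cross_mem_plus {b : complexBetti B.X (2 * n)} {c : complexBetti (weilSurf E₀).X (2 * 1)}
    (hb : b ∈ weilClassesPlus B β n 1) (hc : c ∈ weilClassesPlus (weilSurf E₀) (weilSurfAct E₀ ψ₀) 1 1) :
    cross b c ∈ weilClassesPlus (B.prod (weilSurf E₀))
      (AbelianVariety.prodLift (AbelianVariety.fst B (weilSurf E₀) ≫ β)
        (AbelianVariety.snd B (weilSurf E₀) ≫ weilSurfAct E₀ ψ₀)) (n + 1) 1 :=
  cupProduct_map_fst_map_snd_mem_weilClassesPlus (AbelianVariety.prodLift_fst _ _) (AbelianVariety.prodLift_snd _ _)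
    hb hc

/-- `E₋(B) ⊠ E₋(S) ⊆ E₋(B × S)`. -/
theorem cross_mem_minus {b : complexBetti B.X (2 * n)} {c : complexBetti (weilSurf E₀).X (2 * 1)}
    (hb : b ∈ weilClassesMinus B β n 1) (hc : c ∈ weilClassesMinus (weilSurf E₀) (weilSurfAct E₀ ψ₀) 1 1) :
    cross b c ∈ weilClassesMinus (B.prod (weilSurf E₀))
      (AbelianVariety.prodLift (AbelianVariety.fst B (weilSurf E₀) ≫ β)
        (AbelianVariety.snd B (weilSurf E₀) ≫ weilSurfAct E₀ ψ₀)) (n + 1) 1 :=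
  cupProduct_map_fst_map_snd_mem_weilClassesMinus (AbelianVariety.prodLift_fst _ _) (AbelianVariety.prodLift_snd _ _)
    hb hc

/-- `cross b c ≠ 0` for `b, c ≠ 0` (Künneth injectivity; `B` of dimension `m`, `S` a surface). [cite: HatcherAT2002, Thm. 3.16] -/
theorem cross_ne_zero {m : ℕ} (hB : B.dim = m) (hE : E₀.dim = 1) {b : complexBetti B.X (2 * n)}
    {c : complexBetti (weilSurf E₀).X (2 * 1)} (hb : b ≠ 0) (hc : c ≠ 0) : cross b c ≠ 0 :=
  cupProduct_map_fst_map_snd_ne_zero_of_add_eq (isSmoothProjective_of_dim_eq' hB)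
    (isSmoothProjective_of_dim_eq' (weilSurf_dim hE)) (two_mul_add_two_mul n 1) (by omega) hb hc

/-- `cross` of Gauss-rational classes is Gauss-rational. -/
theorem cross_gaussRat {b : complexBetti B.X (2 * n)} {c : complexBetti (weilSurf E₀).X (2 * 1)} (hb : IsGaussRat b)
    (hc : IsGaussRat c) : IsGaussRat (cross b c) :=
  (hb.map _).cup _ (hc.map _)

/-- **`conj (b ⊠ c) = conj b ⊠ conj c`.** [cite: VoisinHodgeI2002, Cor. 6.12] -/
theorem conjClass_cross (b : complexBetti B.X (2 * n)) (c : complexBetti (weilSurf E₀).X (2 * 1)) :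
    conjClass (ComplexPoints (B.prod (weilSurf E₀)).X) (2 * (n + 1)) (cross b c) =
      cross (conjClass (ComplexPoints B.X) (2 * n) b) (conjClass (ComplexPoints (weilSurf E₀).X) (2 * 1) c) := by
  rw [cross, conjClass_cupProduct, conjClass_complexBetti_map', conjClass_complexBetti_map']
  rfl

variable (ψ₀)

/-- `ee = e ⊠ e` on `S² = pad2Anchor E₀`. -/
def eTwo (v : complexBetti E₀.X 1) : complexBetti (pad2Anchor E₀).X (2 * 2) := cross (eLetter ψ₀ v) (eLetter ψ₀ v)

/-- `eee` on `S³ = pad3Anchor E₀`. -/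
def eThree (v : complexBetti E₀.X 1) : complexBetti (pad3Anchor E₀).X (2 * 3) := cross (eTwo ψ₀ v) (eLetter ψ₀ v)

/-- **`eeee = e₁ ⊠ e₂ ⊠ e₃ ⊠ e₄ ∈ H⁸(S⁴(ℂ); ℂ)`**, nested exactly as `pad4Anchor E₀` (the cell's word `eeee`, pad4lib letter `e`
on every factor). [cite: vanGeemen1994HodgeAV, proof of Thm. 6.12] -/
def eeee (v : complexBetti E₀.X 1) : complexBetti (pad4Anchor E₀).X (2 * 4) := cross (eThree ψ₀ v) (eLetter ψ₀ v)

/-- `ēē` on `S²`. -/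
def ebarTwo (v : complexBetti E₀.X 1) : complexBetti (pad2Anchor E₀).X (2 * 2) :=
  cross (ebarLetter ψ₀ v) (ebarLetter ψ₀ v)

/-- `ēēē` on `S³`. -/
def ebarThree (v : complexBetti E₀.X 1) : complexBetti (pad3Anchor E₀).X (2 * 3) :=
  cross (ebarTwo ψ₀ v) (ebarLetter ψ₀ v)

/-- **`ēēēē = ē₁ ⊠ ē₂ ⊠ ē₃ ⊠ ē₄ ∈ H⁸(S⁴(ℂ); ℂ)`** (the cell's word `ēēēē`). -/
def eeeeBar (v : complexBetti E₀.X 1) : complexBetti (pad4Anchor E₀).X (2 * 4) := cross (ebarThree ψ₀ v) (ebarLetter ψ₀ v)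

variable {ψ₀}

theorem eTwo_mem (hψ : ψ₀ ≫ ψ₀ = -(1 • 𝟙 E₀)) (v : complexBetti E₀.X 1) :
    eTwo ψ₀ v ∈ weilClassesPlus (pad2Anchor E₀) (pad2Action E₀ ψ₀) 2 1 :=
  cross_mem_plus (eLetter_mem hψ v) (eLetter_mem hψ v)

theorem eThree_mem (hψ : ψ₀ ≫ ψ₀ = -(1 • 𝟙 E₀)) (v : complexBetti E₀.X 1) :
    eThree ψ₀ v ∈ weilClassesPlus (pad3Anchor E₀) (pad3Action E₀ ψ₀) 3 1 :=
  cross_mem_plus (eTwo_mem hψ v) (eLetter_mem hψ v)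

/-- **`eeee ∈ E₊(S⁴) = weilClassesPlus (pad4Anchor E₀) (pad4Action E₀ ψ₀) 4 1`.** [cite: Schoen1998HodgeWeilAddendum, §10] -/
theorem eeee_mem (hψ : ψ₀ ≫ ψ₀ = -(1 • 𝟙 E₀)) (v : complexBetti E₀.X 1) :
    eeee ψ₀ v ∈ weilClassesPlus (pad4Anchor E₀) (pad4Action E₀ ψ₀) 4 1 :=
  cross_mem_plus (eThree_mem hψ v) (eLetter_mem hψ v)

theorem ebarTwo_mem (hψ : ψ₀ ≫ ψ₀ = -(1 • 𝟙 E₀)) (v : complexBetti E₀.X 1) :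
    ebarTwo ψ₀ v ∈ weilClassesMinus (pad2Anchor E₀) (pad2Action E₀ ψ₀) 2 1 :=
  cross_mem_minus (ebarLetter_mem hψ v) (ebarLetter_mem hψ v)

theorem ebarThree_mem (hψ : ψ₀ ≫ ψ₀ = -(1 • 𝟙 E₀)) (v : complexBetti E₀.X 1) :
    ebarThree ψ₀ v ∈ weilClassesMinus (pad3Anchor E₀) (pad3Action E₀ ψ₀) 3 1 :=
  cross_mem_minus (ebarTwo_mem hψ v) (ebarLetter_mem hψ v)

/-- **`ēēēē ∈ E₋(S⁴)`.** -/
theorem eeeeBar_mem (hψ : ψ₀ ≫ ψ₀ = -(1 • 𝟙 E₀)) (v : complexBetti E₀.X 1) :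
    eeeeBar ψ₀ v ∈ weilClassesMinus (pad4Anchor E₀) (pad4Action E₀ ψ₀) 4 1 :=
  cross_mem_minus (ebarThree_mem hψ v) (ebarLetter_mem hψ v)

section NeZero

variable (hE : E₀.dim = 1) (hψ : ψ₀ ≫ ψ₀ = -(1 • 𝟙 E₀)) {v : complexBetti E₀.X 1} (hv : IsRationalClass v) (hv0 : v ≠ 0)
include hE hψ hv hv0

theorem eTwo_ne_zero : eTwo ψ₀ v ≠ 0 :=
  cross_ne_zero (weilSurf_dim hE) hE (eLetter_ne_zero hE hψ hv hv0) (eLetter_ne_zero hE hψ hv hv0)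

theorem eThree_ne_zero : eThree ψ₀ v ≠ 0 :=
  cross_ne_zero (dim_prod_eq_two_mul (weilSurf_dim hE) (weilSurf_dim hE)) hE (eTwo_ne_zero hE hψ hv hv0)
    (eLetter_ne_zero hE hψ hv hv0)

/-- **`eeee ≠ 0`.** -/
theorem eeee_ne_zero : eeee ψ₀ v ≠ 0 :=
  cross_ne_zero (dim_prod_eq_two_mul (dim_prod_eq_two_mul (weilSurf_dim hE) (weilSurf_dim hE)) (weilSurf_dim hE)) hE
    (eThree_ne_zero hE hψ hv hv0) (eLetter_ne_zero hE hψ hv hv0)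

theorem ebarTwo_ne_zero : ebarTwo ψ₀ v ≠ 0 :=
  cross_ne_zero (weilSurf_dim hE) hE (ebarLetter_ne_zero hE hψ hv hv0) (ebarLetter_ne_zero hE hψ hv hv0)

theorem ebarThree_ne_zero : ebarThree ψ₀ v ≠ 0 :=
  cross_ne_zero (dim_prod_eq_two_mul (weilSurf_dim hE) (weilSurf_dim hE)) hE (ebarTwo_ne_zero hE hψ hv hv0)
    (ebarLetter_ne_zero hE hψ hv hv0)

/-- **`ēēēē ≠ 0`.** -/
theorem eeeeBar_ne_zero : eeeeBar ψ₀ v ≠ 0 :=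
  cross_ne_zero (dim_prod_eq_two_mul (dim_prod_eq_two_mul (weilSurf_dim hE) (weilSurf_dim hE)) (weilSurf_dim hE)) hE
    (ebarThree_ne_zero hE hψ hv hv0) (ebarLetter_ne_zero hE hψ hv hv0)

end NeZero

section Conj

variable {v : complexBetti E₀.X 1} (hv : IsRationalClass v)
include hv

theorem conjClass_eTwo : conjClass (ComplexPoints (pad2Anchor E₀).X) (2 * 2) (eTwo ψ₀ v) = ebarTwo ψ₀ v := by
  rw [eTwo, conjClass_cross, conjClass_eLetter hv]; rfl

theorem conjClass_eThree : conjClass (ComplexPoints (pad3Anchor E₀).X) (2 * 3) (eThree ψ₀ v) = ebarThree ψ₀ v := by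
  rw [eThree, conjClass_cross, conjClass_eTwo hv, conjClass_eLetter hv]; rfl

/-- **`conj eeee = ēēēē`** (the two Weil lines are complex conjugate, van Geemen Lemma 5.2 (6)).
[cite: vanGeemen1994HodgeAV, proof of Lemma 5.2 (6)] [cite: VoisinHodgeI2002, Cor. 6.12] -/
theorem conjClass_eeee : conjClass (ComplexPoints (pad4Anchor E₀).X) (2 * 4) (eeee ψ₀ v) = eeeeBar ψ₀ v := by
  rw [eeee, conjClass_cross, conjClass_eThree hv, conjClass_eLetter hv]; rfl

theorem eeee_gaussRat : IsGaussRat (eeee ψ₀ v) :=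
  cross_gaussRat (cross_gaussRat (cross_gaussRat (eLetter_gaussRat hv) (eLetter_gaussRat hv)) (eLetter_gaussRat hv))
    (eLetter_gaussRat hv)

theorem eeeeBar_gaussRat : IsGaussRat (eeeeBar ψ₀ v) :=
  cross_gaussRat (cross_gaussRat (cross_gaussRat (ebarLetter_gaussRat hv) (ebarLetter_gaussRat hv))
    (ebarLetter_gaussRat hv)) (ebarLetter_gaussRat hv)

/-- **`eeee + ēēēē` is a RATIONAL class.** -/
theorem eeee_add_eeeeBar_rational : IsRationalClass (eeee ψ₀ v + eeeeBar ψ₀ v) := by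
  rw [← conjClass_eeee hv]
  exact (eeee_gaussRat hv).add_conjClass_rational

/-- **`i·(eeee − ēēēē)` is a RATIONAL class.** -/
theorem I_smul_eeee_sub_eeeeBar_rational : IsRationalClass (Complex.I • (eeee ψ₀ v - eeeeBar ψ₀ v)) := by
  rw [← conjClass_eeee hv]
  exact (eeee_gaussRat hv).I_smul_sub_conjClass_rational

end Conj

end Tower

/-! ## §10.5 The normalised Weil frame and the dictionary theorem `wOf μ = μ·eeee + μ̄·ēēēē` -/

section NormalisedFrame

/-- **`P + M`, `i(P − M)` are `ℂ`-independent** for `P ∈ E₊`, `M ∈ E₋` non-zero (`E₊ ∩ E₋ = 0`, `n, d > 0`). -/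
theorem indep_of_plus_minus {A : AbelianVariety ℂ} {φ : A ⟶ A} {n d : ℕ} (hn : 0 < n) (hd : 0 < d)
    {P M : complexBetti A.X (2 * n)} (hP : P ∈ weilClassesPlus A φ n d) (hM : M ∈ weilClassesMinus A φ n d)
    (hP0 : P ≠ 0) (hM0 : M ≠ 0) (s t : ℂ) (h : s • (P + M) + t • (Complex.I • (P - M)) = 0) : s = 0 ∧ t = 0 := by
  have hsum : (s + t * Complex.I) • P + (s - t * Complex.I) • M = 0 := by
    rw [← h]; module
  have h1 : (s + t * Complex.I) • P ∈ weilClassesPlus A φ n d ⊓ weilClassesMinus A φ n d := by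
    refine Submodule.mem_inf.2 ⟨Submodule.smul_mem _ _ hP, ?_⟩
    rw [eq_neg_of_add_eq_zero_left hsum]
    exact Submodule.neg_mem _ (Submodule.smul_mem _ _ hM)
  rw [(disjoint_weilClassesPlus_weilClassesMinus A φ hn hd).eq_bot, Submodule.mem_bot] at h1
  have h2 : (s - t * Complex.I) • M = 0 := by rwa [h1, zero_add] at hsum
  have e1 : s + t * Complex.I = 0 := (smul_eq_zero.1 h1).resolve_right hP0
  have e2 : s - t * Complex.I = 0 := (smul_eq_zero.1 h2).resolve_right hM0
  have ht : t * Complex.I = 0 := by linear_combination (e1 - e2) / 2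
  exact ⟨by linear_combination (e1 + e2) / 2, (mul_eq_zero.1 ht).resolve_right Complex.I_ne_zero⟩

variable {E₀ : AbelianVariety ℂ} {ψ₀ : E₀ ⟶ E₀}

/-- **THE NORMALISED WEIL FRAME of the anchor `(S⁴, ψ)` (obligation O-W♮ DISCHARGED)**: `r₁ = eeee + ēēēē`,
`r₂ = i·(eeee − ēēēē)`, built from any rational `v ≠ 0` in `H¹(E₀(ℂ); ℂ)` — a `WeilFrame E₀ ψ₀` in the sense of v4 §3 whose
dictionary with the cell's frame is an EQUALITY (`normalisedFrame_wOf`), not an announcement. [cite: vanGeemen1994HodgeAV, 4.9–4.11] -/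
def normalisedFrame (hE : E₀.dim = 1) (hψ : ψ₀ ≫ ψ₀ = -(1 • 𝟙 E₀)) {v : complexBetti E₀.X 1} (hv : IsRationalClass v)
    (hv0 : v ≠ 0) : WeilFrame E₀ ψ₀ where
  rOne := eeee ψ₀ v + eeeeBar ψ₀ v
  rTwo := Complex.I • (eeee ψ₀ v - eeeeBar ψ₀ v)
  rOne_rational := eeee_add_eeeeBar_rational hv
  rTwo_rational := I_smul_eeee_sub_eeeeBar_rational hv
  rOne_mem := Submodule.add_mem _ (weilClassesPlus_le_weilClassesOf _ _ _ _ (eeee_mem hψ v))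
    (weilClassesMinus_le_weilClassesOf _ _ _ _ (eeeeBar_mem hψ v))
  rTwo_mem := Submodule.smul_mem _ _ (Submodule.sub_mem _ (weilClassesPlus_le_weilClassesOf _ _ _ _ (eeee_mem hψ v))
    (weilClassesMinus_le_weilClassesOf _ _ _ _ (eeeeBar_mem hψ v)))
  indep := indep_of_plus_minus (by norm_num) one_pos (eeee_mem hψ v) (eeeeBar_mem hψ v) (eeee_ne_zero hE hψ hv hv0)
    (eeeeBar_ne_zero hE hψ hv hv0)

variable (hE : E₀.dim = 1) (hψ : ψ₀ ≫ ψ₀ = -(1 • 𝟙 E₀)) {v : complexBetti E₀.X 1} (hv : IsRationalClass v) (hv0 : v ≠ 0)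

@[simp] theorem normalisedFrame_rOne : (normalisedFrame hE hψ hv hv0).rOne = eeee ψ₀ v + eeeeBar ψ₀ v := rfl

@[simp] theorem normalisedFrame_rTwo : (normalisedFrame hE hψ hv hv0).rTwo = Complex.I • (eeee ψ₀ v - eeeeBar ψ₀ v) := rfl

/-- **THE DICTIONARY THEOREM: `wOf μ = μ·eeee + μ̄·ēēēē`** for the normalised frame — the class v4 §3 lets a design with
`eeee`-coefficient `μ ∈ ℤ[i]` (C0, the json's `mu`) name IS `μ·eeee + μ̄·ēēēē` (`μ̄ = star μ`). -/
theorem normalisedFrame_wOf (μ : GaussianInt) :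
    (normalisedFrame hE hψ hv hv0).wOf μ =
      GaussianInt.toComplex μ • eeee ψ₀ v + GaussianInt.toComplex (star μ) • eeeeBar ψ₀ v := by
  rw [GaussianInt.toComplex_star, GaussianInt.toComplex_def, WeilFrame.wOf, normalisedFrame_rOne, normalisedFrame_rTwo]
  simp only [map_add, map_mul, map_intCast, Complex.conj_I, Rat.cast_intCast]
  module

/-- `wOf 1 = eeee + ēēēē = r₁`, `wOf i = i(eeee − ēēēē)`… e.g. the unit design: -/
theorem normalisedFrame_wOf_one : (normalisedFrame hE hψ hv hv0).wOf 1 = eeee ψ₀ v + eeeeBar ψ₀ v := by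
  rw [normalisedFrame_wOf, star_one, map_one, one_smul, one_smul]

/-- `wOf` is additive-compatible: `wOf (μ − ν) = wOf μ − wOf ν` (for ANY Weil frame; v4 §3 interface). -/
theorem WeilFrame.wOf_sub (F : WeilFrame E₀ ψ₀) (μ ν : GaussianInt) : F.wOf (μ - ν) = F.wOf μ - F.wOf ν := by
  simp only [WeilFrame.wOf, Zsqrtd.re_sub, Zsqrtd.im_sub, Int.cast_sub, Rat.cast_sub, sub_smul]
  abel

/-- **the `eeee`-coefficient is DETERMINED by the Weil class** (for ANY Weil frame): `wOf` is injective on `ℤ[i]`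
(`wOf μ ≠ 0` for `μ ≠ 0`, v4 `WeilFrame.wOf_ne_zero`). -/
theorem WeilFrame.wOf_injective (F : WeilFrame E₀ ψ₀) : Function.Injective F.wOf := by
  intro μ ν h
  by_contra hne
  exact F.wOf_ne_zero (sub_ne_zero.2 hne) (by rw [WeilFrame.wOf_sub, h, sub_self])

include hE hψ hv hv0 in
/-- **the json's `μ` is determined by the class `μ·eeee + μ̄·ēēēē`** (normalised frame + `wOf_injective`). -/
theorem eq_of_eeee_combination_eq {μ ν : GaussianInt}
    (h : GaussianInt.toComplex μ • eeee ψ₀ v + GaussianInt.toComplex (star μ) • eeeeBar ψ₀ v =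
      GaussianInt.toComplex ν • eeee ψ₀ v + GaussianInt.toComplex (star ν) • eeeeBar ψ₀ v) : μ = ν :=
  (normalisedFrame hE hψ hv hv0).wOf_injective (by rw [normalisedFrame_wOf, normalisedFrame_wOf, h])

end NormalisedFrame

/-! ## §10.7 Dependence on `v`: the letters, `eeee`, `ēēēē` and the normalised frame are determined UP TO A POSITIVE REAL SCALE -/

section Scale

variable {E₀ : AbelianVariety ℂ} {ψ₀ : E₀ ⟶ E₀} {B : AbelianVariety ℂ}

/-- **`V₊(ψ₀)` is a LINE spanned by `x⁺`**: every class `c` with `ψ₀^*c = i·c` is a multiple of `x⁺` (`dim E₀ = 1`: `b₁ = 2`,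
`dim V₊ = dim V₋`). [cite: LangeBirkenhake1992, §1.1 Prop. 1.1.9 (p. 20)] [cite: vanGeemen1994HodgeAV, 4.9] -/
theorem exists_eq_smul_xPlus (hE : E₀.dim = 1) (hψ : ψ₀ ≫ ψ₀ = -(1 • 𝟙 E₀)) {v : complexBetti E₀.X 1}
    (hv : IsRationalClass v) (hv0 : v ≠ 0) (c : complexBetti E₀.X 1)
    (hc : complexBetti.map ψ₀.hom.hom.hom 1 c = Complex.I • c) : ∃ t : ℂ, c = t • xPlus ψ₀ v := by
  haveI : Module.Finite ℂ (complexBetti E₀.X 1) := finite_complexBetti_abelianVariety E₀ 1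
  have hs : Complex.I * ((Real.sqrt ((1 : ℕ) : ℝ) : ℝ) : ℂ) = Complex.I := by
    rw [Nat.cast_one, Real.sqrt_one, Complex.ofReal_one, mul_one]
  have hdim : Module.finrank ℂ (Module.End.eigenspace (complexBetti.map ψ₀.hom.hom.hom 1).hom
      (Complex.I * ((Real.sqrt ((1 : ℕ) : ℝ) : ℝ) : ℂ))) = 1 := by
    have h := two_mul_finrank_eigenspace_eq one_pos hψ
    rw [finrank_complexBetti_one_of_dim_eq_one hE] at h
    omega
  have hxmem : xPlus ψ₀ v ∈ Module.End.eigenspace (complexBetti.map ψ₀.hom.hom.hom 1).hom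
      (Complex.I * ((Real.sqrt ((1 : ℕ) : ℝ) : ℝ) : ℂ)) := by
    rw [Module.End.mem_eigenspace_iff, hs]; exact map_xPlus hψ v
  have hcmem : c ∈ Module.End.eigenspace (complexBetti.map ψ₀.hom.hom.hom 1).hom
      (Complex.I * ((Real.sqrt ((1 : ℕ) : ℝ) : ℝ) : ℂ)) := by
    rw [Module.End.mem_eigenspace_iff, hs]; exact hc
  have hne : (⟨xPlus ψ₀ v, hxmem⟩ : Module.End.eigenspace (complexBetti.map ψ₀.hom.hom.hom 1).hom
      (Complex.I * ((Real.sqrt ((1 : ℕ) : ℝ) : ℝ) : ℂ))) ≠ 0 := fun h =>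
    xPlus_ne_zero hψ hv hv0 (congrArg Subtype.val h)
  obtain ⟨t, ht⟩ := (finrank_eq_one_iff_of_nonzero' _ hne).1 hdim ⟨c, hcmem⟩
  exact ⟨t, (congrArg Subtype.val ht).symm⟩

/-- for two rational generators: `x'⁺ = t·x⁺` for some `t ∈ ℂ`, `t ≠ 0` if `v' ≠ 0`. -/
theorem exists_xPlus_eq_smul (hE : E₀.dim = 1) (hψ : ψ₀ ≫ ψ₀ = -(1 • 𝟙 E₀)) {v v' : complexBetti E₀.X 1}
    (hv : IsRationalClass v) (hv0 : v ≠ 0) (hv' : IsRationalClass v') (hv0' : v' ≠ 0) :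
    ∃ t : ℂ, t ≠ 0 ∧ xPlus ψ₀ v' = t • xPlus ψ₀ v := by
  obtain ⟨t, ht⟩ := exists_eq_smul_xPlus hE hψ hv hv0 (xPlus ψ₀ v') (map_xPlus hψ v')
  refine ⟨t, fun h0 => xPlus_ne_zero hψ hv' hv0' ?_, ht⟩
  rw [ht, h0, zero_smul]

/-- `x'⁺ = t·x⁺ ⟹ x'⁻ = t̄·x⁻` (conjugate). -/
theorem xMinus_eq_smul_of {v v' : complexBetti E₀.X 1} (hv : IsRationalClass v) (hv' : IsRationalClass v') {t : ℂ}
    (ht : xPlus ψ₀ v' = t • xPlus ψ₀ v) : xMinus ψ₀ v' = starRingEnd ℂ t • xMinus ψ₀ v := by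
  rw [← conjClass_xPlus hv', ht, conjClass_smul, conjClass_xPlus hv]

/-- `x'⁺ = t·x⁺ ⟹ e' = (t·t̄)·e = |t|²·e`. -/
theorem eLetter_eq_smul_of {v v' : complexBetti E₀.X 1} (hv : IsRationalClass v) (hv' : IsRationalClass v') {t : ℂ}
    (ht : xPlus ψ₀ v' = t • xPlus ψ₀ v) : eLetter ψ₀ v' = ((Complex.normSq t : ℝ) : ℂ) • eLetter ψ₀ v := by
  rw [← Complex.mul_conj]
  simp only [eLetter, ht, xMinus_eq_smul_of hv hv' ht, map_smul, LinearMap.smul_apply, smul_smul, mul_comm]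

/-- `x'⁺ = t·x⁺ ⟹ ē' = |t|²·ē`. -/
theorem ebarLetter_eq_smul_of {v v' : complexBetti E₀.X 1} (hv : IsRationalClass v) (hv' : IsRationalClass v') {t : ℂ}
    (ht : xPlus ψ₀ v' = t • xPlus ψ₀ v) : ebarLetter ψ₀ v' = ((Complex.normSq t : ℝ) : ℂ) • ebarLetter ψ₀ v := by
  rw [← Complex.mul_conj]
  simp only [ebarLetter, ht, xMinus_eq_smul_of hv hv' ht, map_smul, LinearMap.smul_apply, smul_smul]

/-- `cross` is bilinear: `(r·b) ⊠ (s·c) = (r s)·(b ⊠ c)`. -/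
theorem cross_smul {n : ℕ} (r s : ℂ) (b : complexBetti B.X (2 * n)) (c : complexBetti (weilSurf E₀).X (2 * 1)) :
    cross (r • b) (s • c) = (r * s) • cross b c := by
  simp only [cross, map_smul, LinearMap.smul_apply, smul_smul, mul_comm]

/-- `e' = r·e ⟹ eeee' = r⁴·eeee`. -/
theorem eeee_eq_smul_of {v v' : complexBetti E₀.X 1} {r : ℂ} (he : eLetter ψ₀ v' = r • eLetter ψ₀ v) :
    eeee ψ₀ v' = r ^ 4 • eeee ψ₀ v := by
  rw [show r ^ 4 = r * r * r * r by ring]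
  simp only [eeee, eThree, eTwo, he, cross_smul]

/-- `ē' = r·ē ⟹ ēēēē' = r⁴·ēēēē`. -/
theorem eeeeBar_eq_smul_of {v v' : complexBetti E₀.X 1} {r : ℂ} (he : ebarLetter ψ₀ v' = r • ebarLetter ψ₀ v) :
    eeeeBar ψ₀ v' = r ^ 4 • eeeeBar ψ₀ v := by
  rw [show r ^ 4 = r * r * r * r by ring]
  simp only [eeeeBar, ebarThree, ebarTwo, he, cross_smul]

/-- **FLAG (1) TYPED: the letters are determined by the anchor UP TO ONE POSITIVE REAL SCALE** — for two rational generators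
`v, v' ≠ 0` of `H¹(E₀)`: `e' = r·e`, `ē' = r·ē`, `eeee' = r⁴·eeee`, `ēēēē' = r⁴·ēēēē` with the SAME real `r > 0` (`r = |t|²`). -/
theorem exists_letters_eq_smul (hE : E₀.dim = 1) (hψ : ψ₀ ≫ ψ₀ = -(1 • 𝟙 E₀)) {v v' : complexBetti E₀.X 1}
    (hv : IsRationalClass v) (hv0 : v ≠ 0) (hv' : IsRationalClass v') (hv0' : v' ≠ 0) :
    ∃ r : ℝ, 0 < r ∧ eLetter ψ₀ v' = (r : ℂ) • eLetter ψ₀ v ∧ ebarLetter ψ₀ v' = (r : ℂ) • ebarLetter ψ₀ v ∧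
      eeee ψ₀ v' = (r : ℂ) ^ 4 • eeee ψ₀ v ∧ eeeeBar ψ₀ v' = (r : ℂ) ^ 4 • eeeeBar ψ₀ v := by
  obtain ⟨t, ht0, ht⟩ := exists_xPlus_eq_smul hE hψ hv hv0 hv' hv0'
  exact ⟨Complex.normSq t, Complex.normSq_pos.2 ht0, eLetter_eq_smul_of hv hv' ht, ebarLetter_eq_smul_of hv hv' ht,
    eeee_eq_smul_of (eLetter_eq_smul_of hv hv' ht), eeeeBar_eq_smul_of (ebarLetter_eq_smul_of hv hv' ht)⟩

/-- **the normalised frames of two rational generators differ by ONE POSITIVE REAL SCALE**: `wOf' μ = r·wOf μ` for every `μ ∈ ℤ[i]`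
(`r = |t|⁸ > 0`); in particular the json's `μ` read in either frame agrees up to `ℝ_{>0}` — and a real ratio of two Gaussian integers is
a positive RATIONAL (`toComplex_eq_real_mul`), so up to `ℚ_{>0}`: harmless for (σ) (`μ ≠ 0`) and for the `ℚ(i)`-line a design names. -/
theorem exists_normalisedFrame_wOf_eq_smul (hE : E₀.dim = 1) (hψ : ψ₀ ≫ ψ₀ = -(1 • 𝟙 E₀)) {v v' : complexBetti E₀.X 1}
    (hv : IsRationalClass v) (hv0 : v ≠ 0) (hv' : IsRationalClass v') (hv0' : v' ≠ 0) :
    ∃ r : ℝ, 0 < r ∧ ∀ μ : GaussianInt,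
      (normalisedFrame hE hψ hv' hv0').wOf μ = (r : ℂ) • (normalisedFrame hE hψ hv hv0).wOf μ := by
  obtain ⟨r, hr, -, -, he, hebar⟩ := exists_letters_eq_smul hE hψ hv hv0 hv' hv0'
  refine ⟨r ^ 4, pow_pos hr 4, fun μ => ?_⟩
  rw [normalisedFrame_wOf, normalisedFrame_wOf, he, hebar, Complex.ofReal_pow]
  module

/-- `eeee`, `ēēēē` are `ℂ`-INDEPENDENT (`E₊ ∩ E₋ = 0`). -/
theorem eeee_eeeeBar_indep (hE : E₀.dim = 1) (hψ : ψ₀ ≫ ψ₀ = -(1 • 𝟙 E₀)) {v : complexBetti E₀.X 1}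
    (hv : IsRationalClass v) (hv0 : v ≠ 0) (a b : ℂ) (h : a • eeee ψ₀ v + b • eeeeBar ψ₀ v = 0) : a = 0 ∧ b = 0 := by
  have h1 : a • eeee ψ₀ v ∈ weilClassesPlus (pad4Anchor E₀) (pad4Action E₀ ψ₀) 4 1 ⊓
      weilClassesMinus (pad4Anchor E₀) (pad4Action E₀ ψ₀) 4 1 := by
    refine Submodule.mem_inf.2 ⟨Submodule.smul_mem _ _ (eeee_mem hψ v), ?_⟩
    rw [eq_neg_of_add_eq_zero_left h]
    exact Submodule.neg_mem _ (Submodule.smul_mem _ _ (eeeeBar_mem hψ v))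
  rw [(disjoint_weilClassesPlus_weilClassesMinus _ _ (by norm_num) one_pos).eq_bot, Submodule.mem_bot] at h1
  have h2 : b • eeeeBar ψ₀ v = 0 := by rwa [h1, zero_add] at h
  exact ⟨(smul_eq_zero.1 h1).resolve_right (eeee_ne_zero hE hψ hv hv0),
    (smul_eq_zero.1 h2).resolve_right (eeeeBar_ne_zero hE hψ hv hv0)⟩

/-- **reading `μ` in two frames**: if the class a design names as `μ'` in the `v'`-frame equals the class named `μ` in the `v`-frame,
then `μ = r·μ'` in `ℂ` for ONE real `r > 0` (the frames' scale). -/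
theorem toComplex_eq_real_mul_of_wOf_eq (hE : E₀.dim = 1) (hψ : ψ₀ ≫ ψ₀ = -(1 • 𝟙 E₀)) {v v' : complexBetti E₀.X 1}
    (hv : IsRationalClass v) (hv0 : v ≠ 0) (hv' : IsRationalClass v') (hv0' : v' ≠ 0) {μ μ' : GaussianInt}
    (h : (normalisedFrame hE hψ hv' hv0').wOf μ' = (normalisedFrame hE hψ hv hv0).wOf μ) :
    ∃ r : ℝ, 0 < r ∧ GaussianInt.toComplex μ = (r : ℂ) * GaussianInt.toComplex μ' := by
  obtain ⟨r, hr, hw⟩ := exists_normalisedFrame_wOf_eq_smul hE hψ hv hv0 hv' hv0'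
  refine ⟨r, hr, ?_⟩
  rw [hw μ', normalisedFrame_wOf, normalisedFrame_wOf, smul_add, smul_smul, smul_smul] at h
  have h0 : ((r : ℂ) * GaussianInt.toComplex μ' - GaussianInt.toComplex μ) • eeee ψ₀ v +
      ((r : ℂ) * GaussianInt.toComplex (star μ') - GaussianInt.toComplex (star μ)) • eeeeBar ψ₀ v = 0 := by
    rw [sub_smul, sub_smul, sub_add_sub_comm, h, sub_self]
  exact (sub_eq_zero.1 (eeee_eeeeBar_indep hE hψ hv hv0 _ _ h0).1).symm

/-- a REAL ratio of two Gaussian integers is RATIONAL: `μ = r·μ'` in `ℂ`, `μ' ≠ 0`, `r ∈ ℝ` ⟹ `r ∈ ℚ`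
(`r = (Re μ Re μ' + Im μ Im μ') ∕ N(μ')`). -/
theorem toComplex_eq_real_mul {μ μ' : GaussianInt} (hμ' : μ' ≠ 0) {r : ℝ}
    (h : GaussianInt.toComplex μ = (r : ℂ) * GaussianInt.toComplex μ') : ∃ q : ℚ, (q : ℝ) = r := by
  have hre : (GaussianInt.toComplex μ).re = r * (GaussianInt.toComplex μ').re := by rw [h, Complex.re_ofReal_mul]
  have him : (GaussianInt.toComplex μ).im = r * (GaussianInt.toComplex μ').im := by rw [h, Complex.im_ofReal_mul]
  have hN : (GaussianInt.toComplex μ').re ^ 2 + (GaussianInt.toComplex μ').im ^ 2 ≠ 0 := by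
    intro h0
    have hre0 : (GaussianInt.toComplex μ').re = 0 := by
      nlinarith [sq_nonneg (GaussianInt.toComplex μ').re, sq_nonneg (GaussianInt.toComplex μ').im]
    have him0 : (GaussianInt.toComplex μ').im = 0 := by
      nlinarith [sq_nonneg (GaussianInt.toComplex μ').re, sq_nonneg (GaussianInt.toComplex μ').im]
    exact hμ' (GaussianInt.toComplex_eq_zero.1 (Complex.ext (by simpa using hre0) (by simpa using him0)))
  refine ⟨(μ.re * μ'.re + μ.im * μ'.im : ℚ) / (μ'.re ^ 2 + μ'.im ^ 2 : ℚ), ?_⟩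
  push_cast
  simp only [GaussianInt.intCast_re, GaussianInt.intCast_im]
  rw [div_eq_iff hN, hre, him]
  ring

end Scale

/-! ## §10.6 The checks re-read through the normalised frame -/

section Consumers

variable {E₀ : AbelianVariety ℂ} {ψ₀ : E₀ ⟶ E₀}
variable (hE : E₀.dim = 1) (hψ : ψ₀ ≫ ψ₀ = -(1 • 𝟙 E₀))

/-- **THE ANCHOR KIT WITH THE NORMALISED FRAME**: from a rational `η ≠ 0` with a polarisation datum (O-pol) and O-hyp
(both THEOREMS of v6 for every rational `η ≠ 0`: `polarisation_nonempty`, `hStd_hyperbolic` — not imported here while v6's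
snapshot is unbuilt, hence hypotheses), and a rational `v ≠ 0` in `H¹(E₀)`. Its frame `K.F` IS the json dictionary. -/
def AnchorKit.ofNormalisedFrame {η : complexBetti E₀.X 2} (hη : IsRationalClass η) (hη0 : η ≠ 0)
    (pol : Polarisation E₀ η) (hyp : HStdHyperbolic E₀ ψ₀ η) {v : complexBetti E₀.X 1} (hv : IsRationalClass v)
    (hv0 : v ≠ 0) : AnchorKit E₀ ψ₀ :=
  ⟨η, hη, hη0, normalisedFrame hE hψ hv hv0, pol, hyp⟩

variable {η : complexBetti E₀.X 2} (hη : IsRationalClass η) (hη0 : η ≠ 0) (pol : Polarisation E₀ η)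
  (hyp : HStdHyperbolic E₀ ψ₀ η) {v : complexBetti E₀.X 1} (hv : IsRationalClass v) (hv0 : v ≠ 0)

@[simp] theorem AnchorKit.ofNormalisedFrame_F :
    (AnchorKit.ofNormalisedFrame hE hψ hη hη0 pol hyp hv hv0).F = normalisedFrame hE hψ hv hv0 := rfl

@[simp] theorem AnchorKit.ofNormalisedFrame_η : (AnchorKit.ofNormalisedFrame hE hψ hη hη0 pol hyp hv hv0).η = η := rfl

@[simp] theorem AnchorKit.ofNormalisedFrame_pol :
    (AnchorKit.ofNormalisedFrame hE hψ hη hη0 pol hyp hv hv0).pol = pol := rfl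

/-- **(σ) THE HODGE-CLASS CHECK, read through the normalised frame**: `μ ≠ 0` and `q·h_K⁴ + μ·eeee + μ̄·ēēēē` is supported on
the seed `Z` — the target class is LITERALLY the cell's `W`-component, not a class of an opaque frame. -/
theorem classCheck_ofNormalisedFrame_iff (μ : GaussianInt) {Z : Scheme.{0}} (i : Z ⟶ (pad4Anchor E₀).X.left) (q : ℚ) :
    ClassCheck (AnchorKit.ofNormalisedFrame hE hψ hη hη0 pol hyp hv hv0) μ i q ↔
      μ ≠ 0 ∧ ((q : ℚ) : ℂ) • cupPowTwo (symH (pad4Action E₀ ψ₀) pol.e pol.a) 4 +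
        (GaussianInt.toComplex μ • eeee ψ₀ v + GaussianInt.toComplex (star μ) • eeeeBar ψ₀ v) ∈
          classesSupportedOn (pad4Anchor E₀).X (Set.range i.base) (2 * 4) := by
  unfold ClassCheck
  rw [AnchorKit.ofNormalisedFrame_F, normalisedFrame_wOf]
  rfl

/-- **(A1@Z) AT THE SEED, read through the normalised frame**: `ch_p(𝓔) = c_p·hᵖ` (`p ∈ I ∖ {4}`) and
`ch₄(𝓔) = q·h⁴ + μ·eeee + μ̄·ēēēē` — the honest `ch(𝓔) ∈ ℚ[h] ⊕ (ℚ·eeee ⊕ ℚ·ēēēē)^{conj}` with `W`-coordinate `μ`. -/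
theorem cleanAtSeed_normalisedFrame_iff (C : ChernCharacterBetti) (I : Finset ℕ) (h : complexBetti (pad4Anchor E₀).X 2)
    (𝓔 : (pad4Anchor E₀).X.left.Modules) (μ : GaussianInt) :
    CleanAtSeed C I (normalisedFrame hE hψ hv hv0) h 𝓔 μ ↔
      ∃ (c : ℕ → ℚ) (q : ℚ), (∀ p ∈ I, p ≠ 4 → C.ch (pad4Anchor E₀).X 𝓔 p = ((c p : ℚ) : ℂ) • cupPowTwo h p) ∧
        C.ch (pad4Anchor E₀).X 𝓔 4 = ((q : ℚ) : ℂ) • cupPowTwo h 4 +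
          (GaussianInt.toComplex μ • eeee ψ₀ v + GaussianInt.toComplex (star μ) • eeeeBar ψ₀ v) := by
  unfold CleanAtSeed
  rw [normalisedFrame_wOf]

/-- **`RealisedBy` read through the normalised frame** (sheaf door dictionary): `ch₄(𝓔) = (c₄(D)∕24)·h⁴ + μ(D)·eeee + μ̄(D)·ēēēē`
with `μ(D) = D.mu` the json's `eeee`-coefficient and `μ̄(D) = star (D.mu) = D.mubar` for a real design (`Design.mubar_eq_star_mu`
is v4's; here only `star D.mu` appears). -/
theorem realisedBy_normalisedFrame_iff (D : Design) (C : ChernCharacterBetti) (h : complexBetti (pad4Anchor E₀).X 2)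
    (𝓔 : (pad4Anchor E₀).X.left.Modules) :
    D.RealisedBy C (normalisedFrame hE hψ hv hv0) h 𝓔 ↔
      D.Clean ∧
        (∀ p : Fin 9, (p : ℕ) ≠ 4 →
          C.ch (pad4Anchor E₀).X 𝓔 p = ((((D.coeff p : ℤ) : ℚ) / ((p : ℕ).factorial : ℚ) : ℚ) : ℂ) • cupPowTwo h p) ∧
        C.ch (pad4Anchor E₀).X 𝓔 4 = ((((D.coeff 4 : ℤ) : ℚ) / 24 : ℚ) : ℂ) • cupPowTwo h 4 +
          (GaussianInt.toComplex D.mu • eeee ψ₀ v + GaussianInt.toComplex (star D.mu) • eeeeBar ψ₀ v) := by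
  unfold Design.RealisedBy
  rw [normalisedFrame_wOf]

/-- **LAW (F2) OF THE WORD FRAME IS DEFINITIONAL for the normalised frame**: a word frame `Φ` with `Φ.cls 4 eeee = eeee`,
`Φ.cls 4 ēēēē = ēēēē` and the e-free law (F1) is linked to `normalisedFrame` (v4 §6.2 `WordFrame.LinksTo`). What remains of
obligation O-WF is (F1) alone (the divisor letters `u_f, v_f, p_f`, `Σ_{e-free, deg p} w = hᵖ∕p!`) — NOT constructed here. -/
theorem WordFrame.linksTo_normalisedFrame {v : complexBetti E₀.X 1} (hv : IsRationalClass v) (hv0 : v ≠ 0)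
    (Φ : WordFrame E₀) (h : complexBetti (pad4Anchor E₀).X 2)
    (hF1 : ∀ p : Fin 9, ∑ w ∈ eFreeWordsOfDeg p, Φ.cls p w = (((p : ℕ).factorial : ℕ) : ℂ)⁻¹ • cupPowTwo h p)
    (he : Φ.cls 4 eWord = eeee ψ₀ v) (hebar : Φ.cls 4 ebarWord = eeeeBar ψ₀ v) :
    Φ.LinksTo (normalisedFrame hE hψ hv hv0) h :=
  ⟨hF1, by rw [he, hebar, normalisedFrame_rOne], by rw [he, hebar, normalisedFrame_rTwo]⟩

/-- **O-W♮ ON EVERY CM ANCHOR**: a normalised frame EXISTS for every `(E₀, ψ₀)` with `dim E₀ = 1`, `ψ₀² = −1` (a rational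
`v ≠ 0` in `H¹(E₀(ℂ); ℂ)` exists: `exists_isRationalClass_ne_zero_one`). -/
theorem exists_normalisedFrame :
    ∃ (v : complexBetti E₀.X 1) (hv : IsRationalClass v) (hv0 : v ≠ 0) (F : WeilFrame E₀ ψ₀),
      F = normalisedFrame hE hψ hv hv0 ∧ ∀ μ : GaussianInt,
        F.wOf μ = GaussianInt.toComplex μ • eeee ψ₀ v + GaussianInt.toComplex (star μ) • eeeeBar ψ₀ v := by
  obtain ⟨v, hv, hv0⟩ := exists_isRationalClass_ne_zero_one hE
  exact ⟨v, hv, hv0, _, rfl, normalisedFrame_wOf hE hψ hv hv0⟩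

end Consumers

end Summit.HodgeConjecture.HodgeConjecture.Cruxes.BlochSeedDiscOne.SeedChecker

end
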